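import Literature.NumberTheory.Automorphic.UnitaryGroupBorelConstantTermInvariance
import Literature.NumberTheory.Automorphic.UnitaryGroupArthurKernelClassExpansion
import HarnessLib

/-!
# The class kernels `K_{B,𝔬}`, `k^T_𝔬` of the `𝔬`-expansion on `U(J_N)` are `G(F)`-invariant
# unconditionally (the `B(F)`-invariance input of the accepted letter, discharged)
(Rogawski, *Automorphic Representations of Unitary Groups in Three Variables* (1990), §2.2, p. 13)

Topic `NumberTheory/Automorphic`; namespace `Literature.NumberTheory.Automorphic.UnitaryGroup`.
THEOREMS ONLY over accepted tree modules: no definition, no named fact, no `sorry`, no instance, no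
notation.

The accepted `UnitaryGroupArthurKernelClassExpansion` (the `𝔬`-expansion `K = Σ_𝔬 K_𝔬`,
`k^T = Σ_𝔬 k^T_𝔬`, `J^T = Σ_𝔬 J^T_𝔬` over an abstract class map `cl : G(F) → ι`) proves the
`G(F)`-invariance of `k^T_𝔬` (`truncatedKernelClass_rational_mul`) modulo the input
`hK : K_{B,𝔬}(b y, b y) = K_{B,𝔬}(y, y)` for `b ∈ B(F)`, and isolates the two structural axioms of
Rogawski's semisimple-class partition: `IsConjInvariant cl` (classes are unions of conjugacy classes)
and `IsUnipotentInvariantOnBorel cl` (`cl (β n) = cl β` for `β ∈ B(F)`, `n ∈ N`). Under these two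
axioms `hK` HOLDS, for every `f`, every Haar measure `ν` of `N(𝔸_F)` and every fundamental domain `𝓕`
of `N(F)`, exactly as for the classless kernel (`UnitaryGroupBorelConstantTermInvariance`):

* `borelSumClass_diag_rational_borel_mul` — `Σ_{β ∈ B(F)∩𝔬̲} f((b y)⁻¹ β (b z)) = Σ_{β} f(y⁻¹ β z)`
  (re-index `β ↦ b⁻¹ β b`, `IsConjInvariant`);
* `kernelBorelClass_diag_rational_borel_mul` — **`K_{B,𝔬}(b y, b y) = K_{B,𝔬}(y, y)`**: by the
  previous lemma `K_{B,𝔬}(b y, b y) = ν(𝓕)⁻¹ ∫_𝓕 ψ(b⁻¹ u b) dν(u)` with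
  `ψ(v) = Σ_{β} f(y⁻¹ β v y)`, which is left `N(F)`-invariant (★ `borelSumClass_unipotent_mul`,
  `IsUnipotentInvariantOnBorel`); the conjugation `u ↦ b⁻¹ u b` preserves `N(F)` and hence the
  normalised integral over the fundamental domain (★ `smul_setIntegral_comp_continuousMulEquiv_eq_of_isFundamentalDomain`);
* hence the primed, input-free forms `kernelBorelTailClass_rational_borel_mul'`,
  **`truncatedKernelClass_rational_mul'`** (`k^T_𝔬(γ x) = k^T_𝔬(x)`, `γ ∈ G(F)`),
  `truncatedKernelClass_quotientSubgroup_mul'`, `quotFun_truncatedKernelClass_toAutomorphicQuotient'`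
  [Rogawski1990, §2.2 p. 13: «`k^T_𝔬` is integrable over `𝐙G\𝐆`» — first of all a function there].

## References

* J. D. Rogawski, *Automorphic Representations of Unitary Groups in Three Variables*, Annals of
  Mathematics Studies 123 (1990), §2.2 (p. 13: `K_{P,𝔬}`, `k^T_𝔬`, `J^T_𝔬`) [Rogawski1990].
-/

noncomputable section

open MeasureTheory Measure NumberField IsDedekindDomain Topology Set
open scoped NNReal ENNReal Pointwise

namespace Literature.NumberTheory.Automorphic

namespace UnitaryGroup

variable {F E : Type} [Field F] [NumberField F] [Field E] [NumberField E] [Algebra F E]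
  {c : E ≃ₐ[F] E} {N : ℕ} {ι : Type*}

omit [NumberField F] [Algebra F E] in
/-- `𝔸_E` is Hausdorff (local copy of the standard three-line argument). [folklore] -/
private theorem t2Space_adeleRing_E₄p05 : T2Space (AdeleRing (𝓞 E) E) := by
  haveI : T2Space (FiniteAdeleRing (𝓞 E) E) := inferInstanceAs <| T2Space
    (RestrictedProduct (fun w : HeightOneSpectrum (𝓞 E) => w.adicCompletion E)
      (fun w => (w.adicCompletionIntegers E : Set (w.adicCompletion E))) Filter.cofinite)
  haveI : T2Space (InfiniteAdeleRing E) :=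
    inferInstanceAs <| T2Space ((w : InfinitePlace E) → w.Completion)
  exact inferInstanceAs <| T2Space (InfiniteAdeleRing E × FiniteAdeleRing (𝓞 E) E)

/-- `N(𝔸_F)` is a second countable locally compact group and `N(F)` is countable (private plumbing,
local copy). [folklore] -/
private theorem topology_adelicUnipotent'' :
    LocallyCompactSpace (adelicUnipotent F E c N) ∧ SecondCountableTopology (adelicUnipotent F E c N) ∧
      Countable (rationalUnipotent F E c N) := by
  haveI := secondCountableTopology_adeleRing E
  haveI := locallyCompactSpace_adeleRing' E
  haveI := t2Space_adeleRing_E₄p05 (E := E)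
  haveI : LocallyCompactSpace (quasiSplit F E c N).Adelic :=
    inferInstanceAs (LocallyCompactSpace (adelic F E c N ((StdForm.antidiagonal N).over E)))
  haveI : SecondCountableTopology (quasiSplit F E c N).Adelic :=
    inferInstanceAs (SecondCountableTopology (adelic F E c N ((StdForm.antidiagonal N).over E)))
  have hcl : IsClosed ((adelicUnipotent F E c N : Set (quasiSplit F E c N).Adelic)) := by
    change IsClosed (⇑(adelicVal F E c N ((StdForm.antidiagonal N).over E)) ⁻¹'
      ((upperUnitriangular (Fin N) (AdeleRing (𝓞 E) E) : Subgroup (GL (Fin N) (AdeleRing (𝓞 E) E))) :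
        Set (GL (Fin N) (AdeleRing (𝓞 E) E))))
    exact (isClosed_upperUnitriangular (R := AdeleRing (𝓞 E) E)).preimage continuous_subtype_val
  refine ⟨hcl.locallyCompactSpace, TopologicalSpace.Subtype.secondCountableTopology _, ?_⟩
  have hinj : Function.Injective fun γ : rationalUnipotent F E c N =>
      (⟨((γ : adelicUnipotent F E c N) : (quasiSplit F E c N).Adelic), γ.2⟩ :
        (quasiSplit F E c N).arithmeticSubgroup) := by
    intro a a' h
    exact Subtype.ext (Subtype.ext (congrArg
      (fun z : (quasiSplit F E c N).arithmeticSubgroup => (z : (quasiSplit F E c N).Adelic)) h))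
  haveI : Countable (quasiSplit F E c N).arithmeticSubgroup := by
    haveI : Countable E := NumberField.countable' (K := E)
    haveI : Countable (Matrix (Fin N) (Fin N) E) := inferInstanceAs (Countable (Fin N → Fin N → E))
    haveI : Countable (GL (Fin N) E) := Units.val_injective.countable
    haveI : Countable (quasiSplit F E c N).Rational :=
      inferInstanceAs (Countable (rational F E c N ((StdForm.antidiagonal N).over E)))
    exact (Set.countable_range _).to_subtype
  exact hinj.countable

/-! ## §1 Diagonal `B(F)`-invariance of the class Borel sum -/

/-- **Diagonal `B(F)`-invariance of the class Borel sum**: for a conjugation-invariant class map and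
`b ∈ B(F)`, `Σ_{β ∈ B(F), cl β = 𝔬} f((b y)⁻¹ β (b z)) = Σ_{β ∈ B(F), cl β = 𝔬} f(y⁻¹ β z)` —
re-indexing `β ↦ b⁻¹ β b`, which permutes `B(F)` and each class (Rogawski (1990), §2.2: `𝔬̲` is a
union of conjugacy classes). [cite: Rogawski1990, §2.2 (p. 13)] -/
theorem borelSumClass_diag_rational_borel_mul {cl : (quasiSplit F E c N).arithmeticSubgroup → ι}
    (hcl : IsConjInvariant cl) (i : ι) (f : (quasiSplit F E c N).Adelic → ℂ)
    (b : (quasiSplit F E c N).arithmeticSubgroup) (hb : b ∈ arithmeticBorel F E c N)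
    (y z : (quasiSplit F E c N).Adelic) :
    borelSumClass cl i f ((b : (quasiSplit F E c N).Adelic) * y) ((b : (quasiSplit F E c N).Adelic) * z) =
      borelSumClass cl i f y z := by
  -- conjugation by `b` as a self-equivalence of the fibre `{β ∈ B(F) | cl β = i}`
  let bB : arithmeticBorel F E c N := ⟨b, hb⟩
  have hmem : ∀ β : arithmeticBorel F E c N,
      cl ((bB⁻¹ * β * bB : arithmeticBorel F E c N) : (quasiSplit F E c N).arithmeticSubgroup) =
        cl (β : (quasiSplit F E c N).arithmeticSubgroup) := fun β =>
    hcl.apply_inv_mul_mul (β : (quasiSplit F E c N).arithmeticSubgroup) b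
  have hmem' : ∀ β : arithmeticBorel F E c N,
      cl ((bB * β * bB⁻¹ : arithmeticBorel F E c N) : (quasiSplit F E c N).arithmeticSubgroup) =
        cl (β : (quasiSplit F E c N).arithmeticSubgroup) := fun β =>
    hcl (β : (quasiSplit F E c N).arithmeticSubgroup) b
  let e : ((fun β : arithmeticBorel F E c N => cl β) ⁻¹' {i}) ≃
      ((fun β : arithmeticBorel F E c N => cl β) ⁻¹' {i}) :=
    { toFun := fun β => ⟨bB⁻¹ * β.1 * bB, by
        have h := β.2
        simp only [Set.mem_preimage, Set.mem_singleton_iff] at h ⊢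
        rw [hmem, h]⟩
      invFun := fun β => ⟨bB * β.1 * bB⁻¹, by
        have h := β.2
        simp only [Set.mem_preimage, Set.mem_singleton_iff] at h ⊢
        rw [hmem', h]⟩
      left_inv := fun β => by ext; simp only [mul_inv_cancel_left, mul_assoc, mul_inv_cancel, mul_one]
      right_inv := fun β => by ext; simp only [inv_mul_cancel_left, mul_assoc, inv_mul_cancel, mul_one] }
  rw [borelSumClass_def, borelSumClass_def]
  conv_rhs => rw [← e.tsum_eq]
  refine tsum_congr fun β => ?_
  change f (((b : (quasiSplit F E c N).Adelic) * y)⁻¹ *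
      (((β.1 : arithmeticBorel F E c N) : (quasiSplit F E c N).arithmeticSubgroup) : (quasiSplit F E c N).Adelic) *
        ((b : (quasiSplit F E c N).Adelic) * z)) =
    f (y⁻¹ * ((((bB⁻¹ * β.1 * bB : arithmeticBorel F E c N)) : (quasiSplit F E c N).arithmeticSubgroup) :
      (quasiSplit F E c N).Adelic) * z)
  congr 1
  simp only [Subgroup.coe_mul, Subgroup.coe_inv, mul_inv_rev, mul_assoc]
  rfl

/-! ## §2 `K_{B,𝔬}(b y, b y) = K_{B,𝔬}(y, y)` -/

section Kernel

variable [MeasurableSpace (adelicUnipotent F E c N)] [BorelSpace (adelicUnipotent F E c N)]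

/-- **The diagonal of the class Borel kernel is left `B(F)`-invariant** — the input `hK` of
★ `truncatedKernelClass_rational_mul`, DISCHARGED for every `f`, every Haar measure `ν` of `N(𝔸_F)`
and every fundamental domain `𝓕` of `N(F)`, under Rogawski's two partition axioms
(`IsConjInvariant`, `IsUnipotentInvariantOnBorel`): `K_{B,𝔬}(b y, b y) = ν(𝓕)⁻¹ ∫_𝓕 ψ(b⁻¹ u b) dν(u)`
with `ψ(v) = Σ_{β ∈ B(F)∩𝔬̲} f(y⁻¹ β v y)` left `N(F)`-invariant (★ `borelSumClass_unipotent_mul`), and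
conjugation by `b ∈ B(F)` preserves `N(F)` and the normalised integral
(★ `smul_setIntegral_comp_continuousMulEquiv_eq_of_isFundamentalDomain`). [cite: Rogawski1990, §2.2 (p. 13)] -/
theorem kernelBorelClass_diag_rational_borel_mul {cl : (quasiSplit F E c N).arithmeticSubgroup → ι}
    (hcl : IsConjInvariant cl) (hclN : IsUnipotentInvariantOnBorel F E c N cl)
    (ν : Measure (adelicUnipotent F E c N)) [ν.IsHaarMeasure]
    {𝓕 : Set (adelicUnipotent F E c N)} (h𝓕 : IsFundamentalDomain (rationalUnipotent F E c N) 𝓕 ν)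
    (i : ι) (f : (quasiSplit F E c N).Adelic → ℂ)
    (b : (quasiSplit F E c N).arithmeticSubgroup) (hb : b ∈ arithmeticBorel F E c N)
    (y : (quasiSplit F E c N).Adelic) :
    kernelBorelClass ν 𝓕 cl i f ((b : (quasiSplit F E c N).Adelic) * y) ((b : (quasiSplit F E c N).Adelic) * y) =
      kernelBorelClass ν 𝓕 cl i f y y := by
  obtain ⟨_, _, _⟩ := topology_adelicUnipotent'' (F := F) (E := E) (c := c) (N := N)
  haveI : ν.Regular := inferInstance
  -- the automorphism `u ↦ b⁻¹ u b` of `N(𝔸_F)` preserves `N(F)`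
  have hbB : (b : (quasiSplit F E c N).Adelic) ∈ borelAdelic F E c N := (mem_arithmeticBorel_iff b).1 hb
  obtain ⟨α, hα⟩ := exists_continuousMulEquiv_adelicUnipotent_conj hbB
  have hαΓ : ∀ u : adelicUnipotent F E c N,
      α u ∈ rationalUnipotent F E c N ↔ u ∈ rationalUnipotent F E c N := by
    intro u
    change ((α u : adelicUnipotent F E c N) : (quasiSplit F E c N).Adelic) ∈
        (quasiSplit F E c N).arithmeticSubgroup ↔
      ((u : adelicUnipotent F E c N) : (quasiSplit F E c N).Adelic) ∈ (quasiSplit F E c N).arithmeticSubgroup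
    rw [hα]
    constructor
    · intro h
      have h' := Subgroup.mul_mem _ (Subgroup.mul_mem _ b.2 h) (Subgroup.inv_mem _ b.2)
      have he : (b : (quasiSplit F E c N).Adelic) * ((b : (quasiSplit F E c N).Adelic)⁻¹ *
          (u : (quasiSplit F E c N).Adelic) * (b : (quasiSplit F E c N).Adelic)) *
            (b : (quasiSplit F E c N).Adelic)⁻¹ = (u : (quasiSplit F E c N).Adelic) := by group
      rwa [he] at h'
    · intro h
      exact Subgroup.mul_mem _ (Subgroup.mul_mem _ (Subgroup.inv_mem _ b.2) h) b.2
  -- `ψ(v) = Σ_{β} f(y⁻¹ β v y)` is left `N(F)`-invariant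
  set ψ : adelicUnipotent F E c N → ℂ :=
    fun v => borelSumClass cl i f y ((v : (quasiSplit F E c N).Adelic) * y) with hψ
  have hψΓ : ∀ γ ∈ rationalUnipotent F E c N, ∀ v : adelicUnipotent F E c N, ψ (γ * v) = ψ v := by
    intro γ hγ v
    simp only [hψ, Subgroup.coe_mul, mul_assoc]
    exact borelSumClass_unipotent_mul hclN i f y _ ⟨(γ : (quasiSplit F E c N).Adelic), hγ⟩ γ.2
  -- `K_{B,𝔬}(b y, ·)` at `u b y` is `ψ(b⁻¹ u b)`
  have hint : (fun u : adelicUnipotent F E c N =>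
      borelSumClass cl i f ((b : (quasiSplit F E c N).Adelic) * y)
        ((u : (quasiSplit F E c N).Adelic) * (((b : (quasiSplit F E c N).Adelic)) * y))) =
        fun u => ψ (α u) := by
    funext u
    have h1 : (u : (quasiSplit F E c N).Adelic) * ((b : (quasiSplit F E c N).Adelic) * y) =
        (b : (quasiSplit F E c N).Adelic) *
          (((b : (quasiSplit F E c N).Adelic)⁻¹ * (u : (quasiSplit F E c N).Adelic) *
            (b : (quasiSplit F E c N).Adelic)) * y) := by
      group
    simp only [hψ, hα]
    rw [h1, borelSumClass_diag_rational_borel_mul hcl i f b hb]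
  rw [kernelBorelClass_def, kernelBorelClass_def, borelConstantTerm_def, borelConstantTerm_def, hint]
  exact smul_setIntegral_comp_continuousMulEquiv_eq_of_isFundamentalDomain ν (rationalUnipotent F E c N)
    h𝓕 α hαΓ (f := ψ) hψΓ

variable [NeZero N]

/-- The class cut-off tail is left `B(F)`-invariant, input-free form of
★ `kernelBorelTailClass_rational_borel_mul`. [cite: Rogawski1990, §2.2 (p. 13)] -/
theorem kernelBorelTailClass_rational_borel_mul' {cl : (quasiSplit F E c N).arithmeticSubgroup → ι}
    (hcl : IsConjInvariant cl) (hclN : IsUnipotentInvariantOnBorel F E c N cl)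
    (ν : Measure (adelicUnipotent F E c N)) [ν.IsHaarMeasure]
    {𝓕 : Set (adelicUnipotent F E c N)} (h𝓕 : IsFundamentalDomain (rationalUnipotent F E c N) 𝓕 ν)
    (T : ℝ≥0) (i : ι) (f : (quasiSplit F E c N).Adelic → ℂ)
    (b : (quasiSplit F E c N).arithmeticSubgroup) (hb : b ∈ arithmeticBorel F E c N)
    (y : (quasiSplit F E c N).Adelic) :
    kernelBorelTailClass ν 𝓕 T cl i f ((b : (quasiSplit F E c N).Adelic) * y) =
      kernelBorelTailClass ν 𝓕 T cl i f y :=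
  kernelBorelTailClass_rational_borel_mul
    (fun b' hb' y' => kernelBorelClass_diag_rational_borel_mul hcl hclN ν h𝓕 i f b' hb' y') T b hb y

/-- **`k^T_𝔬` is left `G(F)`-invariant** — ★ `truncatedKernelClass_rational_mul` with its input `hK`
DISCHARGED: `k^T_𝔬(γ x) = k^T_𝔬(x)` for `γ ∈ G(F)`, every `f`, every Haar measure `ν` of `N(𝔸_F)`,
every fundamental domain `𝓕` of `N(F)`, under Rogawski's two partition axioms. [cite: Rogawski1990, §2.2 (p. 13)] -/
theorem truncatedKernelClass_rational_mul' {cl : (quasiSplit F E c N).arithmeticSubgroup → ι}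
    (hcl : IsConjInvariant cl) (hclN : IsUnipotentInvariantOnBorel F E c N cl)
    (ν : Measure (adelicUnipotent F E c N)) [ν.IsHaarMeasure]
    {𝓕 : Set (adelicUnipotent F E c N)} (h𝓕 : IsFundamentalDomain (rationalUnipotent F E c N) 𝓕 ν)
    (T : ℝ≥0) (i : ι) (f : (quasiSplit F E c N).Adelic → ℂ)
    (γ : (quasiSplit F E c N).arithmeticSubgroup) (x : (quasiSplit F E c N).Adelic) :
    truncatedKernelClass ν 𝓕 T cl i f ((γ : (quasiSplit F E c N).Adelic) * x) =
      truncatedKernelClass ν 𝓕 T cl i f x :=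
  truncatedKernelClass_rational_mul hcl
    (fun b hb y => kernelBorelClass_diag_rational_borel_mul hcl hclN ν h𝓕 i f b hb y) T γ x

/-- `k^T_𝔬` is invariant under the quotient subgroup `A_G · G(F) = G(F)` — ★
`truncatedKernelClass_quotientSubgroup_mul` with `hK` discharged. [cite: Rogawski1990, §2.2 (p. 13)] -/
theorem truncatedKernelClass_quotientSubgroup_mul' {cl : (quasiSplit F E c N).arithmeticSubgroup → ι}
    (hcl : IsConjInvariant cl) (hclN : IsUnipotentInvariantOnBorel F E c N cl)
    (ν : Measure (adelicUnipotent F E c N)) [ν.IsHaarMeasure]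
    {𝓕 : Set (adelicUnipotent F E c N)} (h𝓕 : IsFundamentalDomain (rationalUnipotent F E c N) 𝓕 ν)
    (T : ℝ≥0) (i : ι) (f : (quasiSplit F E c N).Adelic → ℂ)
    (γ : (quasiSplit F E c N).Adelic) (hγ : γ ∈ (quasiSplit F E c N).quotientSubgroup)
    (x : (quasiSplit F E c N).Adelic) :
    truncatedKernelClass ν 𝓕 T cl i f (γ * x) = truncatedKernelClass ν 𝓕 T cl i f x :=
  truncatedKernelClass_quotientSubgroup_mul hcl
    (fun b hb y => kernelBorelClass_diag_rational_borel_mul hcl hclN ν h𝓕 i f b hb y) T γ hγ x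

/-- **The integrand of `J^T_𝔬(f)` at the class of `g` is `k^T_𝔬(g⁻¹)`** — ★
`quotFun_truncatedKernelClass_toAutomorphicQuotient` with `hK` discharged: `k^T_𝔬` honestly descends
to `G(𝔸_F)/G(F)`. [cite: Rogawski1990, §2.2 (p. 13)] -/
theorem quotFun_truncatedKernelClass_toAutomorphicQuotient'
    {cl : (quasiSplit F E c N).arithmeticSubgroup → ι}
    (hcl : IsConjInvariant cl) (hclN : IsUnipotentInvariantOnBorel F E c N cl)
    (ν : Measure (adelicUnipotent F E c N)) [ν.IsHaarMeasure]
    {𝓕 : Set (adelicUnipotent F E c N)} (h𝓕 : IsFundamentalDomain (rationalUnipotent F E c N) 𝓕 ν)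
    (T : ℝ≥0) (i : ι) (f : (quasiSplit F E c N).Adelic → ℂ) (g : (quasiSplit F E c N).Adelic) :
    (quasiSplit F E c N).quotFun (truncatedKernelClass ν 𝓕 T cl i f)
        ((quasiSplit F E c N).toAutomorphicQuotient g) =
      truncatedKernelClass ν 𝓕 T cl i f g⁻¹ :=
  quotFun_truncatedKernelClass_toAutomorphicQuotient hcl
    (fun b hb y => kernelBorelClass_diag_rational_borel_mul hcl hclN ν h𝓕 i f b hb y) T g

end Kernel

end UnitaryGroup

end Literature.NumberTheory.Automorphic
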